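import Summits.AtomisticToContinuum.Crystallization.Theorems.OverbindingBudgetAffinePhaseCutB

/-!
# NODE 75 «PhaseCut» (lens-4 g75): MR ⟸ QH ∧ QC ∧ PM beneath 74M — statements, seams, dominance transfer — part 2 of 2 (sequel of `…OverbindingBudgetAffinePhaseCutB`)

Split for the 400-line cap by the landing lane (hand-2 g35); the module docstring of part 1 (`…OverbindingBudgetAffinePhaseCutB`) describes the whole node.  Same namespace; all FQNs unchanged.
0 sorry; standard axioms.
-/


namespace Summit.AtomisticToContinuum.Crystallization.Theorems.OverbindingBudgetAffinePhaseCut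

open scoped BigOperators Classical
open Literature.MathematicalPhysics.StatisticalMechanics
open Literature.Geometry.DiscreteGeometry (IsChargeFree nearestDist nearestDist_nonneg nearestDist_le_dist)
open Summit.AtomisticToContinuum.Crystallization.Theorems.OverbindingBudgetMisfitRegistration (Framed Reg DeepReg)
open Summit.AtomisticToContinuum.Crystallization.Theorems.OverbindingBudgetMisfitWindowStatements (InWindow offCount)
open Summit.AtomisticToContinuum.Crystallization.Theorems.OverbindingBudgetBalancedCensusStatements
open Summit.AtomisticToContinuum.Crystallization.Theorems.OverbindingBudgetHarmonicNormalForm (convexComb_core)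
open Summit.AtomisticToContinuum.Crystallization.Theorems.OverbindingBudgetAffineLadder
open Summit.AtomisticToContinuum.Crystallization.Theorems.OverbindingBudgetAffineMesoCut

variable {N : ℕ}

local notation "E3" => EuclideanSpace ℝ (Fin 3)

/-! ## §6  THE DOMINANCE TRANSFER (PROVED): HD_W(ρc) ⇒ PC_W(ρ, r) for `r(ρc+1) ≤ ρ` -/

/-- **Transfer** `HD_W ⇒ PC_W`: with `1 ≤ r`, `0 ≤ ρc`, `r(ρc + 1) ≤ ρ` on a window `0 < σ₁ ≤ σ₂`, pricing the `ρc`-deep cubic-lettered sites prices the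
cubic-proximate rough sites at `c/(K+1)`, `K = 27(2rσ₂+σ₁)³/σ₁³` (part A shadow packing; the `ρc`-rebate is dominated by the `ρ`-rebate). [this file] -/
theorem balancedCubicRoughGapW_of_cubicGapW {ρ ρ₁ ε₁ θ ε g r ρc σ₁ σ₂ : ℝ} (hr : 1 ≤ r) (hρc : 0 ≤ ρc) (hρ : r * (ρc + 1) ≤ ρ)
    (hσ : 0 < σ₁) (hσσ : σ₁ ≤ σ₂) (h : BalancedCubicGapW ρc ε g σ₁ σ₂) : BalancedCubicRoughGapW ρ ρ₁ ε₁ θ ε g r σ₁ σ₂ := by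
  obtain ⟨c, C, hc, h⟩ := h
  set K : ℝ := 27 / σ₁ ^ 3 * (2 * r * σ₂ + σ₁) ^ 3 with hK
  have hb : 0 ≤ 2 * r * σ₂ + σ₁ := by nlinarith [mul_nonneg (by linarith : (0 : ℝ) ≤ r) (hσ.le.trans hσσ)]
  have hK0 : 0 ≤ K := by rw [hK]; exact mul_nonneg (div_nonneg (by norm_num) (pow_nonneg hσ.le 3)) (pow_nonneg hb 3)
  have hK1 : 0 < K + 1 := by linarith
  set P : ℝ := max C 0 with hP
  have hP0 : 0 ≤ P := le_max_right _ _
  have hCP : C ≤ P := le_max_left _ _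
  set c' : ℝ := c / (K + 1) with hc'
  have hc'0 : 0 < c' := by rw [hc']; positivity
  have hc'c : c' * K ≤ c := by
    rw [hc', div_mul_eq_mul_div, div_le_iff₀ hK1]
    nlinarith
  have hρcρ : ρc ≤ ρ := by nlinarith
  refine ⟨c', P + c', hc'0, fun N y hy => ?_⟩
  obtain ⟨u, hu, e⟩ := h N y hy
  refine ⟨u, hu, ?_⟩
  have ha : (cubicRoughCount ρ ρ₁ ε₁ θ ε g r y : ℝ) ≤ K * cubicCount ρc ε g y + offCount σ₁ σ₂ y := by
    rw [hK]; exact cubicRoughCount_le_cubicCount hr hρc hρ hσ hσσ hy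
  have hd : (notDeepCount ρc ε g y : ℝ) ≤ notDeepCount ρ ε g y := by exact_mod_cast notDeepCount_mono hρcρ y
  have n1 : (0 : ℝ) ≤ cubicCount ρc ε g y := Nat.cast_nonneg _
  have n2 : (0 : ℝ) ≤ notDeepCount ρc ε g y := Nat.cast_nonneg _
  have n3 : (0 : ℝ) ≤ notDeepCount ρ ε g y := Nat.cast_nonneg _
  have n5 : (0 : ℝ) ≤ offCount σ₁ σ₂ y := Nat.cast_nonneg _
  have n6 : (0 : ℝ) ≤ (N : ℝ) ^ (2 / 3 : ℝ) := Real.rpow_nonneg (Nat.cast_nonneg _) _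
  have g1 : 0 ≤ dilGain y + shGain u y := add_nonneg (dilGain_nonneg y) (shGain_nonneg _ y)
  -- upgrade the hypothesis to the nonnegative constant `P`
  have e' : (N : ℝ) * (⨅ Q : PeriodicConfiguration 3, Q.energyPerParticle lennardJones) + c * (cubicCount ρc ε g y : ℝ)
      - P * (notDeepCount ρc ε g y : ℝ) - P * (offCount σ₁ σ₂ y : ℝ) - P * (N : ℝ) ^ (2 / 3 : ℝ) - P * (dilGain y + shGain u y)
      ≤ interactionEnergy lennardJones y := by
    linarith [mul_le_mul_of_nonneg_right hCP n2, mul_le_mul_of_nonneg_right hCP n5, mul_le_mul_of_nonneg_right hCP n6,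
      mul_le_mul_of_nonneg_right hCP g1]
  have step1 : c' * (cubicRoughCount ρ ρ₁ ε₁ θ ε g r y : ℝ) ≤ c * cubicCount ρc ε g y + c' * offCount σ₁ σ₂ y := by
    have h1 := mul_le_mul_of_nonneg_left ha hc'0.le
    have h2 : c' * K * (cubicCount ρc ε g y : ℝ) ≤ c * cubicCount ρc ε g y := mul_le_mul_of_nonneg_right hc'c n1
    linarith
  have step2 : P * (notDeepCount ρc ε g y : ℝ) ≤ (P + c') * notDeepCount ρ ε g y := by
    nlinarith [mul_le_mul_of_nonneg_left hd hP0, mul_nonneg hc'0.le n3]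
  linarith [mul_nonneg hc'0.le n6, mul_nonneg hc'0.le g1]

/-- **Transfer (tame)**: `TameBalancedCubicGap ρc ε g ⇒ TameBalancedCubicRoughGap ρ ρ₁ ε₁ θ ε g r` for `1 ≤ r`, `0 ≤ ρc`, `r(ρc+1) ≤ ρ`. [this file] -/
theorem tameBalancedCubicRoughGap_of_cubicGap {ρ ρ₁ ε₁ θ ε g r ρc : ℝ} (hr : 1 ≤ r) (hρc : 0 ≤ ρc) (hρ : r * (ρc + 1) ≤ ρ)
    (h : TameBalancedCubicGap ρc ε g) : TameBalancedCubicRoughGap ρ ρ₁ ε₁ θ ε g r :=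
  fun δ hδ hδ2 => balancedCubicRoughGapW_of_cubicGapW hr hρc hρ hδ hδ2 (h δ hδ hδ2)

/-! ## §7  EVERY PIECE IS ON THE WEAKER SIDE OF ITS PARENT (PROVED; the converses fail the probe battery) -/

/-- PC_W ⇐ MID_aff,W (prices a subset, same rebates). [this file] -/
theorem balancedCubicRoughGapW_of_affMidGapW {ρ ρ₁ ε₁ θ ε g r σ₁ σ₂ : ℝ} (h : BalancedAffMidGapW ρ ρ₁ ε₁ θ ε g σ₁ σ₂) :
    BalancedCubicRoughGapW ρ ρ₁ ε₁ θ ε g r σ₁ σ₂ := by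
  obtain ⟨c, C, hc, h⟩ := h
  refine ⟨c, C, hc, fun N y hy => ?_⟩
  obtain ⟨u, hu, e⟩ := h N y hy
  refine ⟨u, hu, ?_⟩
  have h0 : (cubicRoughCount ρ ρ₁ ε₁ θ ε g r y : ℝ) ≤ affMidCount ρ ρ₁ ε₁ θ ε g y := by
    exact_mod_cast cubicRoughCount_le_affMidCount y
  nlinarith [mul_le_mul_of_nonneg_left h0 hc.le]

/-- PM_W ⇐ PC_W (prices a subset, same rebates). [this file] -/
theorem balancedMixedRoughGapW_of_cubicRoughGapW {ρ ρ₁ ε₁ θ ε g r σ₁ σ₂ : ℝ} (h : BalancedCubicRoughGapW ρ ρ₁ ε₁ θ ε g r σ₁ σ₂) :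
    BalancedMixedRoughGapW ρ ρ₁ ε₁ θ ε g r σ₁ σ₂ := by
  obtain ⟨c, C, hc, h⟩ := h
  refine ⟨c, C, hc, fun N y hy => ?_⟩
  obtain ⟨u, hu, e⟩ := h N y hy
  refine ⟨u, hu, ?_⟩
  have h0 : (mixedRoughCount ρ ρ₁ ε₁ θ ε g r y : ℝ) ≤ cubicRoughCount ρ ρ₁ ε₁ θ ε g r y := by
    exact_mod_cast mixedRoughCount_le_cubicRoughCount y
  nlinarith [mul_le_mul_of_nonneg_left h0 hc.le]

/-- The pattern «prices a subset, rebates `¬deep` plus a nonnegative extra»: an abstract one-window monotonicity used by QH ⇐ MID_aff and QC ⇐ PC. [this file] -/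
theorem balancedW_mono_core {e E c C R R' D X O S G : ℝ} (h : e + c * R - C * D - C * O - C * S - C * G ≤ E) (hc : 0 ≤ c)
    (hR : R' ≤ R) (hX : D ≤ X) (hD : 0 ≤ D) (hO : 0 ≤ O) (hS : 0 ≤ S) (hG : 0 ≤ G) :
    e + c * R' - max C 0 * X - max C 0 * O - max C 0 * S - max C 0 * G ≤ E := by
  have hC : C ≤ max C 0 := le_max_left _ _
  have hC0 : 0 ≤ max C 0 := le_max_right _ _
  nlinarith [mul_le_mul_of_nonneg_right hC hD, mul_le_mul_of_nonneg_left hX hC0, mul_le_mul_of_nonneg_left hR hc,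
    mul_le_mul_of_nonneg_right hC hO, mul_le_mul_of_nonneg_right hC hS, mul_le_mul_of_nonneg_right hC hG]

/-- QH_W ⇐ MID_aff,W (prices a subset, rebates a superset). [this file] -/
theorem balancedHexRoughGapW_of_affMidGapW {ρ ρ₁ ε₁ θ ε g r σ₁ σ₂ : ℝ} (h : BalancedAffMidGapW ρ ρ₁ ε₁ θ ε g σ₁ σ₂) :
    BalancedHexRoughGapW ρ ρ₁ ε₁ θ ε g r σ₁ σ₂ := by
  obtain ⟨c, C, hc, h⟩ := h
  refine ⟨c, max C 0, hc, fun N y hy => ?_⟩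
  obtain ⟨u, hu, e⟩ := h N y hy
  refine ⟨u, hu, ?_⟩
  have h0 : (hexRoughCount ρ ρ₁ ε₁ θ ε g r y : ℝ) ≤ affMidCount ρ ρ₁ ε₁ θ ε g y := by
    exact_mod_cast hexRoughCount_le_affMidCount y
  have h1 : (notDeepCount ρ ε g y : ℝ) ≤ (((notDeepCount ρ ε g y + cubicRoughCount ρ ρ₁ ε₁ θ ε g r y : ℕ) : ℝ)) := by
    exact_mod_cast Nat.le_add_right _ _
  exact balancedW_mono_core e hc.le h0 h1 (Nat.cast_nonneg _) (Nat.cast_nonneg _) (Real.rpow_nonneg (Nat.cast_nonneg _) _)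
    (add_nonneg (dilGain_nonneg y) (shGain_nonneg _ y))

/-- QC_W ⇐ PC_W (prices a subset, rebates a superset). [this file] -/
theorem balancedFccRoughGapW_of_cubicRoughGapW {ρ ρ₁ ε₁ θ ε g r σ₁ σ₂ : ℝ} (h : BalancedCubicRoughGapW ρ ρ₁ ε₁ θ ε g r σ₁ σ₂) :
    BalancedFccRoughGapW ρ ρ₁ ε₁ θ ε g r σ₁ σ₂ := by
  obtain ⟨c, C, hc, h⟩ := h
  refine ⟨c, max C 0, hc, fun N y hy => ?_⟩
  obtain ⟨u, hu, e⟩ := h N y hy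
  refine ⟨u, hu, ?_⟩
  have h0 : (fccRoughCount ρ ρ₁ ε₁ θ ε g r y : ℝ) ≤ cubicRoughCount ρ ρ₁ ε₁ θ ε g r y := by
    exact_mod_cast fccRoughCount_le_cubicRoughCount y
  have h1 : (notDeepCount ρ ε g y : ℝ) ≤ (((notDeepCount ρ ε g y + mixedRoughCount ρ ρ₁ ε₁ θ ε g r y : ℕ) : ℝ)) := by
    exact_mod_cast Nat.le_add_right _ _
  exact balancedW_mono_core e hc.le h0 h1 (Nat.cast_nonneg _) (Nat.cast_nonneg _) (Real.rpow_nonneg (Nat.cast_nonneg _) _)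
    (add_nonneg (dilGain_nonneg y) (shGain_nonneg _ y))

/-- PC ⇐ MR (tame). [this file] -/
theorem cubicRough_of_affMid {ρ ρ₁ ε₁ θ ε g r : ℝ} (h : TameBalancedAffMidGap ρ ρ₁ ε₁ θ ε g) :
    TameBalancedCubicRoughGap ρ ρ₁ ε₁ θ ε g r :=
  fun δ hδ hδ2 => balancedCubicRoughGapW_of_affMidGapW (h δ hδ hδ2)

/-- QH ⇐ MR (tame). [this file] -/
theorem hexRough_of_affMid {ρ ρ₁ ε₁ θ ε g r : ℝ} (h : TameBalancedAffMidGap ρ ρ₁ ε₁ θ ε g) :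
    TameBalancedHexRoughGap ρ ρ₁ ε₁ θ ε g r :=
  fun δ hδ hδ2 => balancedHexRoughGapW_of_affMidGapW (h δ hδ hδ2)

/-- QC ⇐ PC (tame). [this file] -/
theorem fccRough_of_cubicRough {ρ ρ₁ ε₁ θ ε g r : ℝ} (h : TameBalancedCubicRoughGap ρ ρ₁ ε₁ θ ε g r) :
    TameBalancedFccRoughGap ρ ρ₁ ε₁ θ ε g r :=
  fun δ hδ hδ2 => balancedFccRoughGapW_of_cubicRoughGapW (h δ hδ hδ2)

/-- PM ⇐ PC (tame). [this file] -/
theorem mixedRough_of_cubicRough {ρ ρ₁ ε₁ θ ε g r : ℝ} (h : TameBalancedCubicRoughGap ρ ρ₁ ε₁ θ ε g r) :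
    TameBalancedMixedRoughGap ρ ρ₁ ε₁ θ ε g r :=
  fun δ hδ hδ2 => balancedMixedRoughGapW_of_cubicRoughGapW (h δ hδ hδ2)

/-- **The cut loses nothing (tame)**: `MR ⇒ QH ∧ QC ∧ PM`. [this file] -/
theorem letterCut_of_affMid {ρ ρ₁ ε₁ θ ε g r : ℝ} (h : TameBalancedAffMidGap ρ ρ₁ ε₁ θ ε g) :
    TameBalancedHexRoughGap ρ ρ₁ ε₁ θ ε g r ∧ TameBalancedFccRoughGap ρ ρ₁ ε₁ θ ε g r ∧ TameBalancedMixedRoughGap ρ ρ₁ ε₁ θ ε g r :=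
  ⟨hexRough_of_affMid h, fccRough_of_cubicRough (cubicRough_of_affMid h), mixedRough_of_cubicRough (cubicRough_of_affMid h)⟩

/-- **Radius monotonicity of QH** (tame): `r ≤ r' ⇒ QH(r) ⇒ QH(r')` (fewer priced, more rebated: the single-phase radius is a free dial upward). [this file] -/
theorem tameBalancedHexRoughGap_mono_radius {ρ ρ₁ ε₁ θ ε g r r' : ℝ} (hr : r ≤ r') (h : TameBalancedHexRoughGap ρ ρ₁ ε₁ θ ε g r) :
    TameBalancedHexRoughGap ρ ρ₁ ε₁ θ ε g r' := by
  intro δ hδ hδ2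
  obtain ⟨c, C, hc, h⟩ := h δ hδ hδ2
  refine ⟨c, max C 0, hc, fun N y hy => ?_⟩
  obtain ⟨u, hu, e⟩ := h N y hy
  refine ⟨u, hu, ?_⟩
  have h0 : (hexRoughCount ρ ρ₁ ε₁ θ ε g r' y : ℝ) ≤ hexRoughCount ρ ρ₁ ε₁ θ ε g r y := by
    exact_mod_cast hexRoughCount_anti_radius hr y
  have h1 : (((notDeepCount ρ ε g y + cubicRoughCount ρ ρ₁ ε₁ θ ε g r y : ℕ) : ℝ))
      ≤ (((notDeepCount ρ ε g y + cubicRoughCount ρ ρ₁ ε₁ θ ε g r' y : ℕ) : ℝ)) := by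
    exact_mod_cast Nat.add_le_add_left (cubicRoughCount_mono_radius hr y) _
  exact balancedW_mono_core e hc.le h0 h1 (Nat.cast_nonneg _) (Nat.cast_nonneg _) (Real.rpow_nonneg (Nat.cast_nonneg _) _)
    (add_nonneg (dilGain_nonneg y) (shGain_nonneg _ y))

end Summit.AtomisticToContinuum.Crystallization.Theorems.OverbindingBudgetAffinePhaseCut
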